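import Summits.CriticalPhenomena.CardyFormulaZ2.Theorems.CardyComplexConeSLESixFamiliesGiveCardyCollarDomainsPart2
import Literature.Probability.RandomPlanarGeometry.CollarULC
import Literature.Probability.RandomPlanarGeometry.PlanarDomainsTopology

/-!
# Re-based marked rectangles and metric bookkeeping (helper file 3 for `stub_collarDomains`)

Route `CardyComplexCone`, crux `SLESixFamiliesGiveCardy`, line `collar-touch-sandwich`, STUB E.

* `rebase D' M`: the conformal rectangle on a Jordan domain `D'` with boundary loop re-based at a
  parameter `τ₀` (`s ↦ D'.boundary (s + τ₀)`) and marks at parameters `τ₀ < τ₁ < τ₂ < τ₃ < τ₀ + 1`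
  (`MarkParams`); its carrier, marked points, arcs and the arcs of its chords `chord 0 1`, `chord 0 3`.
* Bookkeeping on a conformal rectangle `R`: equal boundary points have parameters differing by an
  integer, images of parameter intervals that are disjoint modulo `1` are disjoint, the frontier is the
  image of any period; compact sets off a closed nonempty set keep a positive distance; the compact
  collar pieces `collarPiece T h a b = tube ([1, 1 + h] × [a, b])` and their position off the arcs.
-/

noncomputable section

open Set Metric Topology Filter
open Literature.Probability.RandomPlanarGeometry

namespace Summit.CriticalPhenomena.CardyFormulaZ2.Cruxes.SLESixFamiliesGiveCardy.CollarTouchSandwich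

/-! ### Re-based rectangles -/

/-- **Mark parameters** of a re-based rectangle: `τ 0 < τ 1 < τ 2 < τ 3 < τ 0 + 1`. -/
structure MarkParams where
  /-- The four parameters. -/
  τ : Fin 4 → ℝ
  /-- `τ 0 < τ 1`. -/
  lt₀₁ : τ 0 < τ 1
  /-- `τ 1 < τ 2`. -/
  lt₁₂ : τ 1 < τ 2
  /-- `τ 2 < τ 3`. -/
  lt₂₃ : τ 2 < τ 3
  /-- `τ 3 < τ 0 + 1`. -/
  lt₃₀ : τ 3 < τ 0 + 1

/-- **The re-based rectangle**: the Jordan domain `D'` with boundary loop `s ↦ D'.boundary (s + τ 0)` and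
marks `(0, τ 1 - τ 0, τ 2 - τ 0, τ 3 - τ 0)`. -/
def rebase (D' : JordanDomain) (M : MarkParams) : ConformalRectangle where
  carrier := D'.carrier
  boundary s := D'.boundary (s + M.τ 0)
  isOpen := D'.isOpen
  isBounded := D'.isBounded
  isConnected := D'.isConnected
  continuous_boundary := D'.continuous_boundary.comp (continuous_id.add continuous_const)
  periodic_boundary s := by
    show D'.boundary (s + 1 + M.τ 0) = D'.boundary (s + M.τ 0)
    rw [add_right_comm]; exact D'.periodic_boundary _
  injOn_boundary := by
    intro s hs t ht h
    have h' := D'.injOn_boundary_Ico (M.τ 0)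
      ⟨by linarith [hs.1], by linarith [hs.2]⟩ ⟨by linarith [ht.1], by linarith [ht.2]⟩ h
    linarith
  range_boundary := by
    rw [← D'.range_boundary]
    ext z
    constructor
    · rintro ⟨s, rfl⟩; exact ⟨s + M.τ 0, rfl⟩
    · rintro ⟨s, rfl⟩; exact ⟨s - M.τ 0, by simp⟩
  mark := ![0, M.τ 1 - M.τ 0, M.τ 2 - M.τ 0, M.τ 3 - M.τ 0]
  strictMono_mark := by
    have h1 := M.lt₀₁; have h2 := M.lt₁₂; have h3 := M.lt₂₃
    refine Fin.strictMono_iff_lt_succ.2 fun i ↦ ?_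
    fin_cases i <;> simp <;> linarith
  mark_mem i := by
    have h1 := M.lt₀₁; have h2 := M.lt₁₂; have h3 := M.lt₂₃; have h4 := M.lt₃₀
    fin_cases i <;> simp <;> (try constructor) <;> linarith

variable (D' : JordanDomain) (M : MarkParams)

/-- The carrier of the re-based rectangle is that of `D'`. -/
@[simp] theorem carrier_rebase : (rebase D' M).carrier = D'.carrier := rfl

/-- The boundary loop of the re-based rectangle. -/
@[simp] theorem boundary_rebase (s : ℝ) : (rebase D' M).boundary s = D'.boundary (s + M.τ 0) := rfl

/-- The marks of the re-based rectangle. -/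
theorem mark_rebase : (rebase D' M).mark 0 = 0 ∧ (rebase D' M).mark 1 = M.τ 1 - M.τ 0 ∧
    (rebase D' M).mark 2 = M.τ 2 - M.τ 0 ∧ (rebase D' M).mark 3 = M.τ 3 - M.τ 0 := ⟨rfl, rfl, rfl, rfl⟩

/-- The marks of the re-based rectangle, uniformly: `mark i = τ i - τ 0`. -/
theorem mark_rebase_eq (i : Fin 4) : (rebase D' M).mark i = M.τ i - M.τ 0 := by
  fin_cases i
  · show (0 : ℝ) = M.τ 0 - M.τ 0; ring
  all_goals rfl

/-- The marked points of the re-based rectangle are `D'.boundary (τ i)`. -/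
theorem pt_rebase (i : Fin 4) : (rebase D' M).pt i = D'.boundary (M.τ i) := by
  show D'.boundary ((rebase D' M).mark i + M.τ 0) = _
  rw [mark_rebase_eq, sub_add_cancel]

/-- The image of a parameter interval under the re-based loop. -/
theorem image_boundary_rebase (u v : ℝ) :
    (rebase D' M).boundary '' Icc u v = D'.boundary '' Icc (u + M.τ 0) (v + M.τ 0) := by
  rw [show (rebase D' M).boundary = D'.boundary ∘ fun s => s + M.τ 0 from rfl, image_comp, image_add_const_Icc]

/-- The arcs of a Dobrushin domain in terms of its two marks. -/
theorem arc_two (E : DobrushinDomain) :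
    E.arc 0 = E.boundary '' Icc (E.mark 0) (E.mark 1) ∧ E.arc 1 = E.boundary '' Icc (E.mark 1) (E.mark 0 + 1) := by
  constructor
  · rw [MarkedDomain.arc, E.nextMark_of_lt 0 (by decide)]; rfl
  · rw [MarkedDomain.arc, E.nextMark_of_not_lt 1 (by decide)]

/-- **The arcs of the chord `chord 0 1` of the re-based rectangle.** -/
theorem arc_chord01 : ((rebase D' M).chord 0 1 (by decide)).arc 0 = D'.boundary '' Icc (M.τ 0) (M.τ 1) ∧
    ((rebase D' M).chord 0 1 (by decide)).arc 1 = D'.boundary '' Icc (M.τ 1) (M.τ 0 + 1) := by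
  obtain ⟨h0, h1⟩ := arc_two ((rebase D' M).chord 0 1 (by decide))
  rw [h0, h1]
  have e0 : ((rebase D' M).chord 0 1 (by decide)).mark 0 = 0 := rfl
  have e1 : ((rebase D' M).chord 0 1 (by decide)).mark 1 = M.τ 1 - M.τ 0 := rfl
  have eb : ((rebase D' M).chord 0 1 (by decide)).boundary = (rebase D' M).boundary := rfl
  rw [e0, e1, eb, image_boundary_rebase, image_boundary_rebase]
  refine ⟨by rw [zero_add, sub_add_cancel], by rw [sub_add_cancel, add_right_comm, zero_add]⟩

/-- **The arcs of the chord `chord 0 3` of the re-based rectangle.** -/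
theorem arc_chord03 : ((rebase D' M).chord 0 3 (by decide)).arc 0 = D'.boundary '' Icc (M.τ 0) (M.τ 3) ∧
    ((rebase D' M).chord 0 3 (by decide)).arc 1 = D'.boundary '' Icc (M.τ 3) (M.τ 0 + 1) := by
  obtain ⟨h0, h1⟩ := arc_two ((rebase D' M).chord 0 3 (by decide))
  rw [h0, h1]
  have e0 : ((rebase D' M).chord 0 3 (by decide)).mark 0 = 0 := rfl
  have e1 : ((rebase D' M).chord 0 3 (by decide)).mark 1 = M.τ 3 - M.τ 0 := rfl
  have eb : ((rebase D' M).chord 0 3 (by decide)).boundary = (rebase D' M).boundary := rfl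
  rw [e0, e1, eb, image_boundary_rebase, image_boundary_rebase]
  refine ⟨by rw [zero_add, sub_add_cancel], by rw [sub_add_cancel, add_right_comm, zero_add]⟩

/-- **The arcs of the re-based rectangle**: `arc 1 = D'.boundary '' [τ 1, τ 2]` and
`arc 2 = D'.boundary '' [τ 2, τ 3]`. -/
theorem arc_rebase : (rebase D' M).arc 1 = D'.boundary '' Icc (M.τ 1) (M.τ 2) ∧
    (rebase D' M).arc 2 = D'.boundary '' Icc (M.τ 2) (M.τ 3) := by
  obtain ⟨-, n1, n2, -⟩ := MarkedDomain.nextMarks_eq (rebase D' M)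
  simp only [MarkedDomain.arc, n1, n2, mark_rebase_eq, image_boundary_rebase, sub_add_cancel, and_self]

/-! ### Parameters modulo one -/

variable (R : ConformalRectangle)

/-- **Equal boundary points have parameters differing by an integer.** -/
theorem exists_int_of_boundary_eq {x y : ℝ} (h : R.boundary x = R.boundary y) : ∃ n : ℤ, x = y + n := by
  have hf : Int.fract x = Int.fract y :=
    R.injOn_boundary ⟨Int.fract_nonneg x, Int.fract_lt_one x⟩ ⟨Int.fract_nonneg y, Int.fract_lt_one y⟩
      (by rw [R.toJordanDomain.boundary_fract, R.toJordanDomain.boundary_fract, h])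
  obtain ⟨n, hn⟩ := Int.fract_eq_fract.1 hf
  exact ⟨n, by linarith⟩

/-- **Images of parameter intervals disjoint modulo one are disjoint**: if `v < c` and `d < u + 1` then
`∂Ω[u, v] ∩ ∂Ω[c, d] = ∅`. -/
theorem disjoint_image_Icc {u v c d : ℝ} (hvc : v < c) (hdu : d < u + 1) :
    Disjoint (R.boundary '' Icc u v) (R.boundary '' Icc c d) := by
  refine Set.disjoint_left.2 ?_
  rintro _ ⟨y, hy, rfl⟩ ⟨x, hx, hxy⟩
  obtain ⟨n, hn⟩ := exists_int_of_boundary_eq R hxy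
  have h1 : (0 : ℝ) < n := by linarith [hx.1, hy.2]
  have h2 : (n : ℝ) < 1 := by linarith [hx.2, hy.1]
  have h3 : (0 : ℤ) < n := by exact_mod_cast h1
  have h4 : n < (1 : ℤ) := by exact_mod_cast h2
  omega

/-- **The frontier is the image of any period** `[c, c + 1]`. -/
theorem frontier_subset_image_Icc (c : ℝ) : frontier R.carrier ⊆ R.boundary '' Icc c (c + 1) := by
  rw [← R.range_boundary]
  rintro _ ⟨t, rfl⟩
  obtain ⟨y, hy, hyt⟩ := R.periodic_boundary.exists_mem_Ico one_pos t c
  exact ⟨y, ⟨hy.1, hy.2.le⟩, hyt.symm⟩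

/-- Every frontier point lies in `∂Ω[u, v]` or in `∂Ω[v, u + 1]`. -/
theorem frontier_subset_union (u v : ℝ) :
    frontier R.carrier ⊆ R.boundary '' Icc u v ∪ R.boundary '' Icc v (u + 1) := by
  intro z hz
  obtain ⟨t, ht, rfl⟩ := frontier_subset_image_Icc R u hz
  rcases le_or_gt t v with h | h
  · exact Or.inl ⟨t, ⟨ht.1, h⟩, rfl⟩
  · exact Or.inr ⟨t, ⟨h.le, ht.2⟩, rfl⟩

/-! ### Positive distances -/

/-- **A compact set off a closed nonempty set keeps a positive distance from it.** -/
theorem exists_pos_le_infDist {K F : Set ℂ} (hK : IsCompact K) (hF : IsClosed F) (hFne : F.Nonempty)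
    (h : Disjoint K F) : ∃ r > 0, ∀ z ∈ K, r ≤ infDist z F := by
  rcases K.eq_empty_or_nonempty with rfl | hKne
  · exact ⟨1, one_pos, fun z hz => absurd hz (notMem_empty z)⟩
  obtain ⟨z₀, hz₀, hmin⟩ := hK.exists_isMinOn hKne (continuous_infDist_pt F).continuousOn
  refine ⟨infDist z₀ F, (hF.notMem_iff_infDist_pos hFne).1 (Set.disjoint_left.1 h hz₀), fun z hz => hmin hz⟩

/-- **Two disjoint compact sets are at positive distance.** -/
theorem exists_pos_le_dist {K K' : Set ℂ} (hK : IsCompact K) (hK' : IsCompact K') (h : Disjoint K K') :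
    ∃ r > 0, ∀ z ∈ K, ∀ w ∈ K', r ≤ dist z w := by
  rcases K'.eq_empty_or_nonempty with rfl | hne
  · exact ⟨1, one_pos, fun z _ w hw => absurd hw (notMem_empty w)⟩
  obtain ⟨r, hr, hfar⟩ := exists_pos_le_infDist hK hK'.isClosed hne h
  exact ⟨r, hr, fun z hz w hw => (hfar z hz).trans (infDist_le_dist_of_mem hw)⟩

/-! ### Collar pieces -/

variable (T : R.toJordanDomain.TubeData)

/-- **The collar piece** `tube ([1, 1 + h] × [a, b])`. -/
def collarPiece (h a b : ℝ) : Set ℂ := (fun q : ℝ × ℝ => T.tube q.1 q.2) '' (Icc 1 (1 + h) ×ˢ Icc a b)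

/-- The collar piece is compact (for `h < 1`). -/
theorem isCompact_collarPiece {h : ℝ} (hh1 : h < 1) (a b : ℝ) : IsCompact (collarPiece R T h a b) :=
  (isCompact_Icc.prod isCompact_Icc).image_of_continuousOn
    (T.continuousOn_tube.mono fun q hq => ⟨by linarith [hq.1.1], by linarith [hq.1.2]⟩)

/-- Tube points with level in `[1, 1 + h]` and a parameter congruent to one in `[a, b]` lie in the piece. -/
theorem tube_mem_collarPiece {h a b s t : ℝ} (hs : s ∈ Icc 1 (1 + h)) {n : ℤ} (ht : t + n ∈ Icc a b) :
    T.tube s t ∈ collarPiece R T h a b :=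
  ⟨(s, t + n), ⟨hs, ht⟩, by simpa only [mul_one] using (T.periodic_tube s).int_mul n t⟩

/-- **A collar piece over a sub-interval of an open arc range misses the other arcs.** -/
theorem disjoint_collarPiece_arc {h a b : ℝ} (hh1 : h < 1) {i j : Fin 4} (hij : j ≠ i)
    (hab : Icc a b ⊆ Ioo (R.mark i) (R.nextMark i)) : Disjoint (collarPiece R T h a b) (R.arc j) := by
  refine Set.disjoint_left.2 ?_
  rintro _ ⟨⟨s, t⟩, ⟨hs, ht⟩, rfl⟩ hmem
  simp only at hmem hs ht
  rcases hs.1.eq_or_lt with h1 | h1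
  · rw [← h1, T.tube_one] at hmem
    exact R.boundary_not_mem_arc hij (hab ht) hmem
  · exact T.tube_not_mem_closure h1 (by linarith [hs.2]) t
      (frontier_subset_closure (R.arc_subset_frontier j hmem))

/-- **Collar pieces over parameter windows disjoint inside `[0, 1)` are disjoint.** -/
theorem disjoint_collarPiece {h a b a' b' : ℝ} (hh1 : h < 1) (ha : 0 ≤ a) (hb : b < a') (hb' : b' < 1) :
    Disjoint (collarPiece R T h a b) (collarPiece R T h a' b') := by
  refine Set.disjoint_left.2 ?_
  rintro _ ⟨⟨s, t⟩, ⟨hs, ht⟩, rfl⟩ ⟨⟨s', t'⟩, ⟨hs', ht'⟩, he⟩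
  simp only at he hs ht hs' ht'
  have ht0 : (0 : ℝ) ≤ t' := by linarith [ht'.1, ht.1, ht.2]
  have ht1 : t < 1 := by linarith [ht.2, ht'.1, ht'.2]
  have := T.injOn_tube (show ((s', t') : ℝ × ℝ) ∈ {q : ℝ × ℝ | 0 < q.1 ∧ q.1 < 2 ∧ q.2 ∈ Ico (0 : ℝ) 1} from
      ⟨by linarith [hs'.1], by linarith [hs'.2], ht0, by linarith [ht'.2]⟩)
    (show ((s, t) : ℝ × ℝ) ∈ {q : ℝ × ℝ | 0 < q.1 ∧ q.1 < 2 ∧ q.2 ∈ Ico (0 : ℝ) 1} from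
      ⟨by linarith [hs.1], by linarith [hs.2], by linarith [ht.1], ht1⟩) he
  have htt : t' = t := congrArg Prod.snd this
  linarith [ht.2, ht'.1]

/-- **Main statement of this file** (registered helper stub, arrow style): the marked points of the
re-based rectangle. -/
theorem rebase_pt : ∀ (D' : JordanDomain) (M : MarkParams) (i : Fin 4), (rebase D' M).pt i = D'.boundary (M.τ i) :=
  fun D' M i => pt_rebase D' M i

end Summit.CriticalPhenomena.CardyFormulaZ2.Cruxes.SLESixFamiliesGiveCardy.CollarTouchSandwich

end
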